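import Literature.NumberTheory.EllipticCurves.KrizLi2019.TwoPartBSDTwists
import Literature.NumberTheory.EllipticCurves.AnticyclotomicPConverseLinks
import Literature.NumberTheory.EllipticCurves.LocalTorsionAdditiveReductionPPrimaryProofs
import Literature.NumberTheory.EllipticCurves.LocalTorsionMultiplicativeProofs
import Literature.NumberTheory.EllipticCurves.ComplexMultiplicationCoatesWilesSeparationProofs
import Literature.NumberTheory.EllipticCurves.ComplexMultiplicationCoatesWilesReductionIndexProofs
import HarnessLib

/-!
# Kriz–Li 2019, Lemma 5.4 (FMS) = arXiv:1606.03172 Lemma 4.1, FIRST STEP — PROVED: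
# Assumption (★) makes the Heegner point `2`-PRIMITIVE (`P ∉ 2E(K) + E(K)_tors`)

Source: D. Kriz, C. Li, *Goldfeld's conjecture and congruences between Heegner points*, Forum Math. Sigma 7
(2019) e15, §5.1 «BSD(2) for `E/K`», Lemma 5.4 (journal p. 32; = arXiv:1606.03172v3 §4.1 Lemma 4.1
`lem:indivisibleby2`), whose proof reads (verbatim, arXiv l. 820–826): «If it is not a 2-adic unit, then there
exists some `Q ∈ E(K)` such that `2Q` is an odd multiple of `P`. … Hence up to a 2-adic unit, we have
`|Ẽ^{ns}(𝔽₂)|·log_{ω_E}P / 2 = |Ẽ^{ns}(𝔽₂)|·log_E P / 2 = |Ẽ^{ns}(𝔽₂)|·log_E(Q)`. On the other hand,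
`c₂(E)·|Ẽ^{ns}(𝔽₂)|·Q` lies in the formal group `Ê(2𝒪_{K₂})` and `c₂(E)` is assumed to be odd, we know that
`|Ẽ^{ns}(𝔽₂)|·log_E(Q) ∈ 2𝒪_{K₂}`, which contradicts (★).»

This file PROVES that step on the tree's objects (nothing is asserted as a named fact):

* `WeierstrassCurve.norm_padicFormalLog_le` — for a `p`-integral equation over `ℚ_p`, `‖log_W(t)‖ ≤ p⁻¹` whenever
  `‖t‖ ≤ p⁻¹` (the coefficients of `log_W` are `bₙ/n`, `bₙ ∈ ℤ_p`, and `n·p^{−n} ≤ p^{−1}`); hence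
  `WeierstrassCurve.norm_padicLogPoint_le_of_isInReductionKernel`: **`log_W(z(Q)) ∈ pℤ_p` for `Q ∈ E₁(ℚ_p)`**
  (the sentence «lies in the formal group … `log ∈ 2𝒪_{K₂}`»). [Silverman AEC IV.6.3–6.4, VII.2.2]
* `nsPointCountAtTwo_eq_reductionPointCount` — Kriz–Li's printed case table for `|Ẽ^{ns}(𝔽₂)|` (`3 − a₂` /
  `1` / `3` / `2`) IS the tree's `reductionPointCount W 2` (AEC Ex. 3.5, tree `reductionPointCount_of_mult`,
  `reductionPointCount_of_additive`); `formalIndex_eq_localTamagawaNumber_mul_reductionPointCount` —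
  `[E(ℚ_p) : E₁(ℚ_p)] = c_p · #Ẽ_ns(𝔽_p)` (AEC VII.2.1, tree `index_formalFiltration`); so Kriz–Li's multiplier
  `c₂·|Ẽ^{ns}(𝔽₂)|` is exactly the index `m₀` of the kernel of reduction and `(c₂·n₂) • X ∈ E₁(ℚ₂)` for every
  `X ∈ E(ℚ₂)` (`isInReductionKernel_tamagawa_mul_nsPointCountAtTwo_nsmul`).
* **`not_exists_two_nsmul_add_torsion_of_assumptionStar`** — for `W/ℚ` globally minimal, a parametrisation datum
  `Dt` with ODD `Dt.c`, `c₂(E)` ODD, `P ∈ E(K)`, `j : K → ℚ₂` with `AssumptionStar W Dt K P j`: there are NO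
  `Q, T ∈ E(K)` with `T` of finite order and `P = 2Q + T`.  Corollaries `not_exists_two_nsmul_eq_of_assumptionStar`
  (`T = 0`), `not_exists_two_zsmul_eq_of_assumptionStar` (`(2 : ℤ) •`), and `not_isOfFinAddOrder_of_assumptionStar`
  (`P` itself has infinite order: a torsion point has vanishing logarithm).

NOT here: the rest of Lemma 5.4 (oddness of the Manin constant via Abbes–Ullmo; the index statement
`[E(K):ℤP]/c_E ∈ ℤ₂ˣ`, which needs `E(K)[2] = 0`), Cor. 5.5, Theorems 4.3 / 5.1 (named facts in
`KrizLi2019/TwoPartBSDTwists.lean`).  No elliptic curve is shown to satisfy (★) here.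
-/

set_option autoImplicit false

noncomputable section

open scoped Classical

/-! ## §1 `log_W(E₁(ℚ_p)) ⊆ pℤ_p` -/

namespace WeierstrassCurve

variable {p : ℕ} [Fact p.Prime] (V : WeierstrassCurve ℚ_[p]) [V.IsIntegral ℤ_[p]]

/-- **`‖log_W(t)‖_p ≤ p⁻¹` for `‖t‖_p ≤ p⁻¹`** (`W/ℚ_p` with `p`-integral coefficients): every term of
`log_W(t) = Σ (bₙ/n) tⁿ` has `‖(bₙ/n) tⁿ‖ ≤ n · p^{−n} ≤ p^{−1}` (`bₙ ∈ ℤ_p`, AEC IV.6.3(a); `n ≤ p^{n−1}`), and the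
norm on `ℚ_p` is non-archimedean (the bound passes to the `tsum`, junk value `0` included).
[cite: SilvermanAEC2009, IV.6.3 (a) and IV.6.4 (a)] -/
theorem norm_padicFormalLog_le {t : ℚ_[p]} (ht : ‖t‖ ≤ (p : ℝ)⁻¹) :
    ‖V.padicFormalLog t‖ ≤ (p : ℝ)⁻¹ := by
  have hp2 : 2 ≤ p := (Fact.out : p.Prime).two_le
  have hp0 : (0 : ℝ) < p := by exact_mod_cast (Fact.out : p.Prime).pos
  have hpi : (0 : ℝ) ≤ (p : ℝ)⁻¹ := inv_nonneg.mpr hp0.le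
  unfold padicFormalLog
  refine IsUltrametricDist.norm_tsum_le_of_forall_le_of_nonneg hpi fun n => ?_
  rw [norm_mul, norm_pow]
  rcases Nat.eq_zero_or_pos n with rfl | hn
  · have h0 : ‖PowerSeries.coeff 0 V.formalLog‖ ≤ ((0 : ℕ) : ℝ) := V.norm_coeff_formalLog_le 0
    rw [Nat.cast_zero] at h0
    rw [le_antisymm h0 (norm_nonneg _), zero_mul]
    exact hpi
  · have hnat : n ≤ p ^ (n - 1) := by
      have h2 : n ≤ 2 ^ (n - 1) := by
        have := @Nat.lt_two_pow_self (n - 1)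
        omega
      exact h2.trans (Nat.pow_le_pow_left hp2 _)
    have hreal : (n : ℝ) ≤ (p : ℝ) ^ (n - 1) := by exact_mod_cast hnat
    calc ‖PowerSeries.coeff n V.formalLog‖ * ‖t‖ ^ n ≤ (n : ℝ) * ((p : ℝ)⁻¹) ^ n := by
          gcongr
          exact V.norm_coeff_formalLog_le n
      _ = (n : ℝ) * ((p : ℝ)⁻¹) ^ (n - 1) * (p : ℝ)⁻¹ := by
          rw [mul_assoc, ← pow_succ, Nat.sub_add_cancel hn]
      _ ≤ (p : ℝ) ^ (n - 1) * ((p : ℝ)⁻¹) ^ (n - 1) * (p : ℝ)⁻¹ := by gcongr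
      _ = (p : ℝ)⁻¹ := by rw [← mul_pow, mul_inv_cancel₀ hp0.ne', one_pow, one_mul]

/-- **`log_W(z(Q)) ∈ pℤ_p` for `Q ∈ E₁(ℚ_p)`**: `‖log_W(z(Q))‖_p ≤ p⁻¹` (since `‖z(Q)‖ ≤ p⁻¹` on the kernel of
reduction, tree `norm_formalParameter_le_inv`). Kriz–Li's «`Q` lies in the formal group `Ê(2𝒪_{K₂})` … `log_E(Q) ∈
2𝒪_{K₂}`» at `p = 2` over `ℚ₂`. [cite: SilvermanAEC2009, IV.6.4 (a) with VII.2.2] -/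
theorem norm_padicLogPoint_le_of_isInReductionKernel {Q : V.toAffine.Point} (hQ : V.IsInReductionKernel Q) :
    ‖V.padicLogPoint Q‖ ≤ (p : ℝ)⁻¹ :=
  V.norm_padicFormalLog_le (V.norm_formalParameter_le_inv hQ)

end WeierstrassCurve

/-! ## §2 Kriz–Li's multiplier `c₂ · |Ẽ^{ns}(𝔽₂)|` is the index of the kernel of reduction -/

namespace Literature.NumberTheory.EllipticCurves.KrizLi2019

open _root_.WeierstrassCurve Literature.NumberTheory.EllipticCurves Literature.NumberTheory.EllipticCurves.ModularForms

variable (W : WeierstrassCurve ℚ) [W.IsElliptic] [W.IsGloballyMinimal]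

/-- **Kriz–Li's `|Ẽ^{ns}(𝔽₂)|` is the tree's `reductionPointCount W 2`**: the printed case table (FMS Rem. 1.17:
«`ℓ + 1 − a_ℓ(E)` if `ℓ ∤ N`, `ℓ ± 1` if `ℓ ∥ N` and `ℓ` if `ℓ² ∣ N`» at `ℓ = 2`) agrees case by case with the
number of points of the reduced cubic (nonsingular ones with `Õ`): good — by the definition of `frobeniusTrace`;
split / non-split node — `reductionPointCount_of_mult` (AEC Ex. 3.5); cusp — `reductionPointCount_of_additive`.
[cite: KrizLi2019, Rem. 1.17 (FMS)] [cite: SilvermanAEC2009, Exercise 3.5] -/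
theorem nsPointCountAtTwo_eq_reductionPointCount : nsPointCountAtTwo W = W.reductionPointCount 2 := by
  haveI : Fact (Nat.Prime 2) := ⟨Nat.prime_two⟩
  unfold nsPointCountAtTwo
  split_ifs with hgood hsplit hmult
  · have h : (3 : ℤ) - W.frobeniusTrace 2 = (W.reductionPointCount 2 : ℤ) := by
      rw [WeierstrassCurve.frobeniusTrace]
      push_cast
      ring
    rw [h, Int.toNat_natCast]
  · have h := (LocalTorsionMult.reductionPointCount_of_mult W 2 hsplit.hasMultiplicativeReductionAtPrime).1 hsplit
    omega
  · have h := (LocalTorsionMult.reductionPointCount_of_mult W 2 hmult).2 hsplit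
    omega
  · exact (reductionPointCount_of_additive W 2 hgood hmult).symm

/-- **`m₀ = [E(ℚ_p) : E₁(ℚ_p)] = c_p · #Ẽ_ns(𝔽_p)`** for a globally minimal `W/ℚ` read over `ℚ_p` (AEC VII.2.1; tree
`index_formalFiltration` at level `1`, the reduction of `W ⊗ ℚ_p` being `integralModelInt W` modulo `p`).
[cite: SilvermanAEC2009, VII.2 Prop. 2.1 and VII.6.1] -/
theorem formalIndex_eq_localTamagawaNumber_mul_reductionPointCount (p : ℕ) [Fact p.Prime] :
    formalIndex W p = (W.baseChange ℚ_[p]).localTamagawaNumber ℤ_[p] * W.reductionPointCount p := by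
  haveI : (W.baseChange ℚ_[p]).IsMinimal ℤ_[p] := isMinimal_map_padic_of_isGloballyMinimal W p
  have key : ∀ (X : WeierstrassCurve ℚ_[p]) [X.IsMinimal ℤ_[p]],
      ((integralModelInt W).map (Int.castRingHom ℤ_[p])).baseChange ℚ_[p] = X →
        Nat.card (X.reduction ℤ_[p]).toAffine.Point = W.reductionPointCount p := by
    intro X _ hX
    subst hX
    rw [reduction_baseChange_eq]
    exact natCard_point_padicModel_residue W p
  unfold formalIndex
  rw [index_formalFiltration (W.baseChange ℚ_[p]) (le_refl 1), pow_zero, mul_one,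
    key (W.baseChange ℚ_[p]) (padicModel_baseChange W p)]

/-- **Kriz–Li's multiplier is the index of the kernel of reduction**: `c₂(E) · |Ẽ^{ns}(𝔽₂)| = [E(ℚ₂) : E₁(ℚ₂)]`
(`formalIndex W 2`). [cite: KrizLi2019, Lemma 5.4 (FMS), proof («`c₂(E)·|Ẽ^{ns}(𝔽₂)|·Q` lies in the formal group»)]
[cite: SilvermanAEC2009, VII.2 Prop. 2.1] -/
theorem tamagawa_mul_nsPointCountAtTwo_eq_formalIndex :
    haveI : Fact (Nat.Prime 2) := ⟨Nat.prime_two⟩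
    (W.baseChange ℚ_[2]).localTamagawaNumber ℤ_[2] * nsPointCountAtTwo W = formalIndex W 2 := by
  haveI : Fact (Nat.Prime 2) := ⟨Nat.prime_two⟩
  rw [nsPointCountAtTwo_eq_reductionPointCount, formalIndex_eq_localTamagawaNumber_mul_reductionPointCount]

/-- **`(c₂ · |Ẽ^{ns}(𝔽₂)|) • X ∈ E₁(ℚ₂)` for every `X ∈ E(ℚ₂)`** (the index of a subgroup kills the quotient).
[cite: KrizLi2019, Lemma 5.4 (FMS), proof] [cite: SilvermanAEC2009, VII.2 Prop. 2.1] -/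
theorem isInReductionKernel_tamagawa_mul_nsPointCountAtTwo_nsmul
    (X : haveI : Fact (Nat.Prime 2) := ⟨Nat.prime_two⟩; (W.baseChange ℚ_[2]).toAffine.Point) :
    haveI : Fact (Nat.Prime 2) := ⟨Nat.prime_two⟩
    (W.baseChange ℚ_[2]).IsInReductionKernel
      (((W.baseChange ℚ_[2]).localTamagawaNumber ℤ_[2] * nsPointCountAtTwo W) • X) := by
  haveI : Fact (Nat.Prime 2) := ⟨Nat.prime_two⟩
  rw [tamagawa_mul_nsPointCountAtTwo_eq_formalIndex]
  exact (((W.baseChange ℚ_[2]).mem_formalFiltration_iff).mp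
    (AddSubgroup.nsmul_index_mem ((W.baseChange ℚ_[2]).formalFiltration 1) X)).1

/-! ## §3 (★) ⟹ the Heegner point is `2`-primitive -/

/-- A point of finite order in the kernel of reduction has vanishing logarithm (`k • X = O`, `log(k • X) =
k · log X`, `log O = 0`). [cite: SilvermanAEC2009, IV.6.4 and VII.2.2] -/
theorem padicLogPoint_eq_zero_of_isOfFinAddOrder_of_isInReductionKernel (p : ℕ) [Fact p.Prime]
    {X : (W.baseChange ℚ_[p]).toAffine.Point} (hX : (W.baseChange ℚ_[p]).IsInReductionKernel X)
    (hfin : IsOfFinAddOrder X) : (W.baseChange ℚ_[p]).padicLogPoint X = 0 := by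
  obtain ⟨k, hk, hkX⟩ := hfin.exists_nsmul_eq_zero
  have hlog := (AcPConverseLinks.padicLogPoint_nsmul W p X hX k).2
  rw [hkX, WeierstrassCurve.padicLogPoint_zero] at hlog
  have hk0 : (k : ℚ_[p]) ≠ 0 := by exact_mod_cast hk.ne'
  rcases mul_eq_zero.mp hlog.symm with h | h
  · exact absurd h hk0
  · exact h

/-- **Kriz–Li, Lemma 5.4 (FMS) = arXiv Lemma 4.1, first step: under Assumption (★) the Heegner point is NOT of the
form `2Q + T` with `T` torsion.**  `W/ℚ` globally minimal; `Dt` a parametrisation datum with `Dt.c` ODD (the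
printed `c_E`); `c₂(E)` ODD; `P ∈ E(K)`; `j : K → ℚ₂`; `AssumptionStar W Dt K P j`.  Proof (the printed one):
with `m = c₂·|Ẽ^{ns}(𝔽₂)|`, `m • X ∈ E₁(ℚ₂)` for all `X`; if `P = 2Q + T` then `log(m•P₂) = 2·log(m•Q₂) + log(m•T₂)
= 2·log(m•Q₂)` has norm `≤ 2⁻¹·2⁻¹`, whereas (★) (with `c₂`, `c_E` `2`-adic units) says `‖log(m•P₂)‖ = 2⁻¹`.
[cite: KrizLi2019, Lemma 5.4 (FMS p. 32; = arXiv:1606.03172 Lemma 4.1), proof] -/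
theorem not_exists_two_nsmul_add_torsion_of_assumptionStar {N : ℕ} [NeZero N]
    (Dt : ModularParametrizationData W N) (K : Type) [Field K] [NumberField K]
    (P : (W.baseChange K).toAffine.Point) (j : K →ₐ[ℚ] ℚ_[2]) (hstar : AssumptionStar W Dt K P j)
    (hc2 : haveI : Fact (Nat.Prime 2) := ⟨Nat.prime_two⟩; Odd ((W.baseChange ℚ_[2]).localTamagawaNumber ℤ_[2]))
    (hc : Odd Dt.c) :
    ¬ ∃ Q T : (W.baseChange K).toAffine.Point, IsOfFinAddOrder T ∧ P = 2 • Q + T := by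
  haveI : Fact (Nat.Prime 2) := ⟨Nat.prime_two⟩
  haveI : (W.baseChange ℚ_[2]).IsMinimal ℤ_[2] := isMinimal_map_padic_of_isGloballyMinimal W 2
  rintro ⟨Q, T, hT, rfl⟩
  obtain ⟨-, hnorm⟩ := hstar
  set E₂ := W.baseChange ℚ_[2] with hE₂
  set m : ℕ := (W.baseChange ℚ_[2]).localTamagawaNumber ℤ_[2] * nsPointCountAtTwo W with hm
  set f := WeierstrassCurve.Affine.Point.map (W' := W) j with hf
  -- `m • X ∈ E₁(ℚ₂)`
  have hQ₁ : E₂.IsInReductionKernel (m • f Q) := isInReductionKernel_tamagawa_mul_nsPointCountAtTwo_nsmul W (f Q)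
  have hT₁ : E₂.IsInReductionKernel (m • f T) := isInReductionKernel_tamagawa_mul_nsPointCountAtTwo_nsmul W (f T)
  -- `m • P₂ = 2 • (m • Q₂) + m • T₂`
  have hmap : m • f (2 • Q + T) = 2 • (m • f Q) + m • f T := by
    rw [map_add, map_nsmul, nsmul_add, smul_smul, smul_smul, mul_comm]
  -- the logarithms
  obtain ⟨h2Q₁, hlog2Q⟩ := AcPConverseLinks.padicLogPoint_nsmul W 2 (m • f Q) hQ₁ 2
  have hadd := padicLogPoint_add_holds 2 E₂ (2 • (m • f Q)) (m • f T) h2Q₁ hT₁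
  have hTfin : IsOfFinAddOrder (m • f T) := (f.isOfFinAddOrder hT).nsmul
  have hTlog : E₂.padicLogPoint (m • f T) = 0 :=
    padicLogPoint_eq_zero_of_isOfFinAddOrder_of_isInReductionKernel W 2 hT₁ hTfin
  have hval : E₂.padicLogPoint (m • f (2 • Q + T)) = (2 : ℚ_[2]) * E₂.padicLogPoint (m • f Q) := by
    rw [hmap, hadd.2, hlog2Q, hTlog, add_zero, Nat.cast_ofNat]
  -- the bound `‖log(m • P₂)‖ ≤ 2⁻¹ · 2⁻¹`
  have h2norm : ‖(2 : ℚ_[2])‖ = 2⁻¹ := by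
    have h := Padic.norm_p (p := 2)
    exact_mod_cast h
  have hQlog : ‖E₂.padicLogPoint (m • f Q)‖ ≤ 2⁻¹ := by
    have h := E₂.norm_padicLogPoint_le_of_isInReductionKernel hQ₁
    exact_mod_cast h
  have hbound : ‖E₂.padicLogPoint (m • f (2 • Q + T))‖ ≤ 2⁻¹ * 2⁻¹ := by
    rw [hval, norm_mul, h2norm]
    gcongr
  -- (★): `‖log(m • P₂)‖ = 2⁻¹` since `c₂` and `c_E` are `2`-adic units
  have hc2n : ‖(((W.baseChange ℚ_[2]).localTamagawaNumber ℤ_[2] : ℕ) : ℚ_[2])‖ = 1 :=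
    Padic.norm_natCast_eq_one_iff.mpr (Nat.coprime_two_left.mpr hc2)
  have hcn : ‖((Dt.c : ℤ) : ℚ_[2])‖ = 1 := by
    refine le_antisymm (Padic.norm_int_le_one _) (not_lt.mp fun hlt => ?_)
    rw [Padic.norm_intCast_lt_one_iff] at hlt
    exact Int.not_even_iff_odd.mpr hc (even_iff_two_dvd.mpr (by exact_mod_cast hlt))
  rw [norm_div, norm_mul, hc2n, hcn, mul_one, div_one] at hnorm
  rw [hnorm] at hbound
  norm_num at hbound

/-- **(★) ⟹ `P ∉ 2E(K)`** (the case `T = 0`). [cite: KrizLi2019, Lemma 5.4 (FMS; = arXiv Lemma 4.1), proof] -/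
theorem not_exists_two_nsmul_eq_of_assumptionStar {N : ℕ} [NeZero N]
    (Dt : ModularParametrizationData W N) (K : Type) [Field K] [NumberField K]
    (P : (W.baseChange K).toAffine.Point) (j : K →ₐ[ℚ] ℚ_[2]) (hstar : AssumptionStar W Dt K P j)
    (hc2 : haveI : Fact (Nat.Prime 2) := ⟨Nat.prime_two⟩; Odd ((W.baseChange ℚ_[2]).localTamagawaNumber ℤ_[2]))
    (hc : Odd Dt.c) :
    ¬ ∃ Q : (W.baseChange K).toAffine.Point, 2 • Q = P := by
  rintro ⟨Q, hQ⟩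
  exact not_exists_two_nsmul_add_torsion_of_assumptionStar W Dt K P j hstar hc2 hc
    ⟨Q, 0, IsOfFinAddOrder.zero, by rw [add_zero, hQ]⟩

/-- **(★) ⟹ `P ∉ 2E(K)`, `ℤ`-scalar form** (`(2 : ℤ) • Q ≠ P`). [cite: KrizLi2019, Lemma 5.4 (FMS; = arXiv Lemma 4.1), proof] -/
theorem not_exists_two_zsmul_eq_of_assumptionStar {N : ℕ} [NeZero N]
    (Dt : ModularParametrizationData W N) (K : Type) [Field K] [NumberField K]
    (P : (W.baseChange K).toAffine.Point) (j : K →ₐ[ℚ] ℚ_[2]) (hstar : AssumptionStar W Dt K P j)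
    (hc2 : haveI : Fact (Nat.Prime 2) := ⟨Nat.prime_two⟩; Odd ((W.baseChange ℚ_[2]).localTamagawaNumber ℤ_[2]))
    (hc : Odd Dt.c) :
    ¬ ∃ Q : (W.baseChange K).toAffine.Point, (2 : ℤ) • Q = P := by
  rintro ⟨Q, hQ⟩
  refine not_exists_two_nsmul_eq_of_assumptionStar W Dt K P j hstar hc2 hc ⟨Q, ?_⟩
  rw [← hQ, ← natCast_zsmul]
  rfl

/-- **(★) ⟹ `P` has infinite order** (a torsion point is `2 • O + P`; equivalently its logarithm vanishes).
[cite: KrizLi2019, Lemma 5.4 (FMS; = arXiv Lemma 4.1), proof] -/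
theorem not_isOfFinAddOrder_of_assumptionStar {N : ℕ} [NeZero N]
    (Dt : ModularParametrizationData W N) (K : Type) [Field K] [NumberField K]
    (P : (W.baseChange K).toAffine.Point) (j : K →ₐ[ℚ] ℚ_[2]) (hstar : AssumptionStar W Dt K P j)
    (hc2 : haveI : Fact (Nat.Prime 2) := ⟨Nat.prime_two⟩; Odd ((W.baseChange ℚ_[2]).localTamagawaNumber ℤ_[2]))
    (hc : Odd Dt.c) : ¬ IsOfFinAddOrder P := fun hP =>
  not_exists_two_nsmul_add_torsion_of_assumptionStar W Dt K P j hstar hc2 hc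
    ⟨0, P, hP, by rw [smul_zero, zero_add]⟩

end Literature.NumberTheory.EllipticCurves.KrizLi2019

end
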